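import Literature.MathematicalPhysics.QuantumLattice.HubbardScaleReportCT

/-!
# Crux `AposterioriOrderCriterionR` (item `stmt-HubbardSuperconductivity-13884`): the free coupling `U = 0`

Negative-side lemmas of the standing disprover (cdisprove cycle 2; no definition is introduced).  At `U = 0` in the
bare frame the two scale-dependent factors of the scale-`Λ₀` mean-field free energy are trivial
(`deformedEffPartitionFn_free = 1`, `deformedEffAction_free = 0`), so **`mfFreeEnergy_free`**:
`f_MF(a, μ', h') = -(βL²)⁻¹ freeLogDet`, and the three reported responses (`scaleStiffness`, `scaleCompressibility`,
`scaleMeanFieldDensity`, and their CT versions at `K = 0`) DO NOT DEPEND ON THE SCALE `Λ₀`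
(`…_free_eq`); `freeLogDet_zero_twist` identifies the summand at zero twist with `log(ω² + ξ² + h'²φ²)` (smooth in
`h'`, so the `deriv` defining `m₀` is an honest derivative: `m₀ = (βL²)⁻¹Σ hφ²/(ω² + ξ² + h²φ²)`, the
Matsubara-truncated free BdG anomalous density, `→ dWaveSourceDensity L 0 μ h` as `M, β → ∞`, `= O(h log(1/h))`).
Consequence for the crux (workfile `Cruxes/AposterioriOrderCriterionR/Disproof.lean` §3, §3b): every datum certified
at `U = 0` through the bare frame has `meanFieldDensity.fst ≤ 0`, so no `U = 0` instance refutes it, and the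
threshold `(kStar Λ₀)² ≤ ρ_s κ` is met at `U = 0` by shrinking `Λ₀` (responses unchanged).
-/


noncomputable section

namespace Summit.HubbardSuperconductivity.HubbardSuperconductivity.Theorems.AposterioriOrderCriterionR.Negative

open Literature.MathematicalPhysics.QuantumLattice Literature.Probability.LatticeModels
open Filter Set GrassmannAlgebra

/-! ### At `U = 0` in the bare frame the response functional is the free log-determinant -/

section FreeCoupling

variable (L M : ℕ) [NeZero L]

omit [NeZero L] in
/-- `Z = ∫ dμ_C e^{0} = 1` for the zero interaction. [folklore] -/
theorem effPartitionFn_zero_interaction {Γ : Type*} [Fintype Γ] (C : Matrix Γ Γ ℂ) :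
    effPartitionFn ℂ C 0 = 1 := by
  rw [effPartitionFn, effBoltzmann, neg_zero, grassmannExp, IsNilpotent.exp_zero, gaussConv_one, map_one]

/-- At `U = 0` the deformed above-scale partition function is `1` … [folklore] -/
theorem deformedEffPartitionFn_free (β μ Λ₀ μ' h' a : ℝ) : deformedEffPartitionFn L M β 0 μ Λ₀ μ' h' a = 1 := by
  rw [deformedEffPartitionFn, hubbardInteraction_zero_coupling, effPartitionFn_zero_interaction]

/-- … and the deformed effective action is `0`. [folklore] -/
theorem deformedEffAction_free (β μ Λ₀ μ' h' a : ℝ) : deformedEffAction L M β 0 μ Λ₀ μ' h' a = 0 := by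
  rw [deformedEffAction, hubbardInteraction_zero_coupling, effAction_zero_interaction]

omit [NeZero L] in
/-- The quadratic part of `0` is `0`. [folklore] -/
theorem quadraticPart_zero {Γ : Type*} [Fintype Γ] [DecidableEq Γ] : quadraticPart (0 : GrassmannAlgebra ℂ Γ) = 0 := by
  simp [quadraticPart]

/-- **At `U = 0` the scale-`Λ₀` mean-field free energy is the free log-determinant**, for EVERY `Λ₀` (the
two scale-dependent factors are `log 1 = 0`): `f_MF(a, μ', h') = -(βL²)⁻¹ Σ_k log|det(-iω_k + M_{a,μ',h'}(k⃗))|`. [folklore] -/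
theorem mfFreeEnergy_free (β μ Λ₀ μ' h' a : ℝ) :
    mfFreeEnergy L M β 0 μ Λ₀ μ' h' a = -(1 / (β * (L : ℝ) ^ 2)) * freeLogDet L M β μ' h' a := by
  rw [mfFreeEnergy, deformedEffPartitionFn_free, norm_one, Real.log_one, add_zero, deformedEffAction_free,
    quadraticPart_zero, neg_zero, grassmannExp, IsNilpotent.exp_zero, gaussExpect_one, norm_one, Real.log_one, add_zero]

/-- Hence at `U = 0` the three bare-frame responses do not depend on the scale `Λ₀` at all … [folklore] -/
theorem scaleMeanFieldDensity_free_eq (β μ h Λ₀ Λ₀' : ℝ) :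
    scaleMeanFieldDensity L M β 0 μ h Λ₀ = scaleMeanFieldDensity L M β 0 μ h Λ₀' := by
  simp only [scaleMeanFieldDensity, mfFreeEnergy_free]

/-- … nor does the free stiffness … [folklore] -/
theorem scaleStiffness_free_eq (β μ h Λ₀ Λ₀' : ℝ) :
    scaleStiffness L M β 0 μ h Λ₀ = scaleStiffness L M β 0 μ h Λ₀' := by
  simp only [scaleStiffness, mfFreeEnergy_free]

/-- … nor the free compressibility. [folklore] -/
theorem scaleCompressibility_free_eq (β μ h Λ₀ Λ₀' : ℝ) :
    scaleCompressibility L M β 0 μ h Λ₀ = scaleCompressibility L M β 0 μ h Λ₀' := by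
  simp only [scaleCompressibility, mfFreeEnergy_free]

/-- … explicitly, the free mean-field density is `m₀ = ½ (βL²)⁻¹ ∂_{h'} Σ_k log|den_k(h')|` at `h' = h`. [folklore] -/
theorem scaleMeanFieldDensity_free (β μ h Λ₀ : ℝ) :
    scaleMeanFieldDensity L M β 0 μ h Λ₀ =
      -(1 / 2) * deriv (fun h' => -(1 / (β * (L : ℝ) ^ 2)) * freeLogDet L M β μ h' 0) h := by
  simp only [scaleMeanFieldDensity, mfFreeEnergy_free]

/-- The same in the CT vocabulary (bare frame `K = 0`): the CT responses at `U = 0`, `K = 0` are `Λ₀`-independent. [folklore] -/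
theorem scaleMeanFieldDensityCT_free_zero_frame_eq (β μ h Λ₀ Λ₀' : ℝ) :
    scaleMeanFieldDensityCT L M β 0 μ h 0 Λ₀ = scaleMeanFieldDensityCT L M β 0 μ h 0 Λ₀' := by
  rw [scaleMeanFieldDensityCT_zero_frame, scaleMeanFieldDensityCT_zero_frame, scaleMeanFieldDensity_free_eq]

/-- At zero twist the free denominator is the real positive BCS denominator `ω² + ξ² + h'²φ²`: the summand of the
free log-determinant is `log(ω² + ξ² + (h'φ)²)`, smooth in `h'` — so `deriv` above is an honest derivative and
`m₀ = (βL²)⁻¹ Σ_{n,k} h φ_k²/(ω_n² + ξ_k² + h²φ_k²)` (the Matsubara-truncated free BdG anomalous density; on paper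
`→ (h/2L²)Σ_k φ_k² tanh(βE_k/2)/E_k`, then `→ dWaveSourceDensity L 0 μ h` as `β → ∞`, `= O(h log(1/h))` as `L → ∞`). [folklore] -/
theorem freeLogDet_zero_twist (β μ' h' : ℝ) :
    freeLogDet L M β μ' h' 0 = ∑ k : FreqMomentum L M, Real.log (nambuDen L M β μ' h' k) := by
  rw [freeLogDet]
  refine Finset.sum_congr rfl fun k _ => ?_
  have h0 : 0 ≤ nambuDen L M β μ' h' k := by rw [nambuDen]; positivity
  rw [deformedNambuDen_zero, Complex.norm_real, Real.norm_eq_abs, abs_of_nonneg h0]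

end FreeCoupling

end Summit.HubbardSuperconductivity.HubbardSuperconductivity.Theorems.AposterioriOrderCriterionR.Negative
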